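import Summits.QuantumFields.BalabanUV.T4Continuum.Support.ColourCovariantLaplacian
import Literature.MathematicalPhysics.QuantumFieldTheory.Balaban1983to89.B5Action121

/-!
# T⁴ programme, spine node NE2 (U1a) — THE GAUGE-TERM SANDWICH `D_R·X·D_Rᴴ` (tier B, row B4.a of `t4/SKELETON-NE2-P1.md`):
# typed covariant gradient on colour 0-forms, the exact four-term decomposition of `D_R X D_Rᴴ − ∂X₀∂ᴴ ⊗ 1`, and its
# one-level (H-bd) bound from (1.89) — the ONE NEW SHAPE of the skeleton, with the 0-form operator `X` as DATA

NE2 formalisation swarm `t4-ne2-formalise-*`, seat LEAF 10 (unit `b2b-balaban-t4-ne2-formalise-leaf-10`), row B4.a of the owner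
lineage's skeleton (`t4-ne2-p1`, trigger `t4/T4-NE2-TRIGGER.json`, t4-ref2 pass 58, conditions c1–c6).  Bałaban's covariant operator
of [Balaban1985BackgroundPropagators] (3.26) p.395 is «Δ_a = Δ + DRD* + Q*aQ», `R = R(U)` the orthogonal projection (3.25) p.394 on
`L²(Ω₀, 𝔤)`, `D = D_U` the covariant gradient from 0-forms to 1-forms; at `U = 1` this is [Balaban1984PropagatorsI] (1.69) p.29
«⟨A, Δ_aA⟩ = ⟨A, ∂*∂A⟩ + ⟨A, ∂R∂*A⟩ + a⟨A, Q*QA⟩ = ⟨A, ΔA⟩ − ⟨A, ∂P∂*A⟩ + a⟨A, Q*QA⟩, Δ = ∂*∂ + ∂∂*, R = I − P» with `P` the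
projection (1.70) p.30.  The tier-B perturbation family `P_k = Δ_a(U_k) − Δ_a(1) ⊗ 1` therefore has, besides the Laplacian summand
(row B2, `ColourCovariantLaplacian`) and the averaging summand (row B3), the GAUGE summand `D_U X_U D_Uᴴ − (∂ X₀ ∂ᴴ) ⊗ 1` with `X`
a bounded operator on colour 0-forms (`X_U = R(U)` or `P(U)`, `X₀` its `U = 1` value).  This file types that summand at MODEL LEVEL
(transporters `R` and the 0-form operators `X`, `X₀` are DATA — no assertion that they are Bałaban's, skeleton B0 / trigger c5):

 * §1 the COMPONENT INJECTIONS `injM μ` (a scalar function as the `μ`-component of a vector function) with `injMᴴ·injM = 1`,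
   `‖injM‖ ≤ 1`, and the intertwiners `S_ν·injM_μ = injM_μ·S^s_ν`, `∇_ν·injM_μ = injM_μ·∂_ν`, `injM_μᴴ·∇_ν = ∂_ν·injM_μᴴ`
   against the scalar calculus of `B5Action121` (`shiftS`, `sdiff`, `GradOp`); `GradOp = Σ_μ injM_μ ∂_μ = Σ_μ ∇_μ injM_μ`;
 * §2 the COVARIANT GRADIENT ON COLOUR 0-FORMS `covGrad c R = Σ_μ c·(siteMul(R_μ)·(S_μ ⊗ 1) − 1)·(injM_μ ⊗ 1)`
   (`(D_Rλ)(x, μ) = c·(R_μ(x)λ(x + e_μ) − λ(x))`, [Balaban1985BackgroundPropagators] (3.3) p.390, shape), its DEFECT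
   `E = covGrad − ∂ ⊗ 1 = Σ_μ siteMul(w_μ)·(S_μ ⊗ 1)·(injM_μ ⊗ 1)`, `w_μ = c(R_μ − 1)` (`covGrad_eq`, `covGrad_one`), the SANDWICH
   `sand c R X = D_R·X·D_Rᴴ` and the EXACT FOUR-TERM DECOMPOSITION
   `sand R X − sand 1 X₀ = (∂⊗1)(X − X₀)(∂⊗1)ᴴ + E X (∂⊗1)ᴴ + (∂⊗1) X Eᴴ + E X Eᴴ` (`sand_sub_sand`), `(sand R X)ᴴ = sand R Xᴴ`;
 * §3 the hypothesis STRUCTURE `GradComm c X ξ ρ` on a 0-form operator (size `‖X‖ ≤ ξ`, gradient commutators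
   `‖[∂_λ ⊗ 1, X]‖ ≤ ρ`) with the instances `1` (`ρ = 0`), differences, and site multiplications by a Lipschitz colour field;
 * §3 also: the GENERIC SANDWICH BOUND **`opNorm_grad_mul_mul_le`** `‖(∂ ⊗ 1)·X·B‖ ≤ d(ξb₁ + ρb₀)` for `‖B‖ ≤ b₀`,
   `‖(∂_λ ⊗ 1)B‖ ≤ b₁` (the left-most difference moved through `X` at the price of one commutator), and `‖E‖ ≤ d·α`.
 The companion file `Support/GaugeTermSandwichBound` feeds `B = (∂ ⊗ 1)ᴴ(𝒢 ⊗ 1)` and `B = Eᴴ(𝒢 ⊗ 1)` with the (1.89) bounds of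
 [Balaban1984PropagatorsI] Prop. 1.1 (tree theorems, incl. the fifth bound `‖∇_λ∇_μ𝒢‖ ≤ Cst`) and proves the one-level (H-bd)
 bound `‖(D_R X D_Rᴴ − D_1 X₀ D_1ᴴ)(𝒢 ⊗ 1)‖ ≤ κ_sand`; (H-cons) and the tower packaging are row B4.b.

HONEST FRAMING (T4-DAG p. 1).  [folklore] lattice algebra and operator-norm bookkeeping, OURS; the only printed input is (1.89)
through the tree's kernel theorems; `X`, `X₀`, `R` are DATA (whether Bałaban's `R(U_k)` satisfies `GradComm` with small `ξ₀, ρ₀` is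
NOT claimed — per trigger c4 a failure there is a located non-applicability of row B4, not hidden); finite torus, linear layer,
operator norm; NOT [B9] (3.23)–(3.26) as printed; NE2 NOT proved; NOT infinite volume / mass gap / Clay / summit progress; spine 0/9
unchanged.  HONEST DEPENDENCY: continuum YM on T⁴ ⇐ BetaPertH ∧ nine spine estimates (0/9 proved); BetaPertH ⇐ (D1) ∧ (D4) ∧
CAP+tail; G-an2-4 gates asym, D1 and NE2/3/4.  ABSOLUTE RULE kept; no `sorry`.
-/

noncomputable section

open scoped BigOperators ComplexConjugate Matrix Matrix.Norms.L2Operator Kronecker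

namespace Summit.QuantumFields.BalabanUV.T4Continuum.GaugeTermDecomposition

open Literature.MathematicalPhysics.QuantumFieldTheory.Balaban1983to89.B5Prop11Plancherel
open Literature.MathematicalPhysics.QuantumFieldTheory.Balaban1983to89.B5Action121 (shiftS sdiff GradOp)
open Summit.QuantumFields.BalabanUV.T4Continuum
open Summit.QuantumFields.BalabanUV.T4Continuum.BalabanBlockPoincare (transl transl_add shiftM_eq_transl opNorm_transl_le)
open Summit.QuantumFields.BalabanUV.T4Continuum.BlockPairingGeometry (tau conjTranspose_transl conjTranspose_shiftM_mul opNorm_shiftM_le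
  fdiff_eq_neg_conjTranspose_mul)
open Summit.QuantumFields.BalabanUV.T4Continuum.BlockPairingFaces (opNorm_calG_mul_fdiff_le)
open Summit.QuantumFields.BalabanUV.T4Continuum.KroneckerLift
open Summit.QuantumFields.BalabanUV.T4Continuum.BlockMultiplication
open Summit.QuantumFields.BalabanUV.T4Continuum.KroneckerUnits
open Summit.QuantumFields.BalabanUV.T4Continuum.AbelianCovariantLaplacian (star_natCast_complex)

variable {d : ℕ}

/-! ## §1 Component injections and the scalar calculus -/

section Inj

variable (Nf : Fin d → ℕ) [hNf : ∀ μ, NeZero (Nf μ)]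

/-- **component injection**: the scalar function `λ` as the `μ`-th component of a vector function, `(injM_μ λ)(x, ν) = [ν = μ]·λ(x)`.
[folklore] -/
def injM (μ : Fin d) : Matrix (Tor Nf × Fin d) (Tor Nf) ℂ := fun i y => if i = (y, μ) then 1 else 0

omit hNf in
/-- entries of the adjoint. [folklore] -/
theorem injM_conjTranspose_apply (μ : Fin d) (y : Tor Nf) (i : Tor Nf × Fin d) :
    (injM Nf μ)ᴴ y i = if i = (y, μ) then 1 else 0 := by
  rw [Matrix.conjTranspose_apply, injM]; split_ifs <;> simp

/-- `injMᴴ·injM = 1` (an isometry). [folklore] -/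
theorem conjTranspose_injM_mul_injM (μ : Fin d) : (injM Nf μ)ᴴ * injM Nf μ = 1 := by
  ext y y'
  rw [Matrix.mul_apply, Finset.sum_eq_single (y, μ)]
  · simp only [injM_conjTranspose_apply, injM, if_true, one_mul, Matrix.one_apply, Prod.mk.injEq, and_true]
  · intro i _ hi
    rw [injM_conjTranspose_apply, if_neg hi, zero_mul]
  · intro h; exact absurd (Finset.mem_univ _) h

/-- `‖injM_μ‖ ≤ 1`. [folklore] -/
theorem opNorm_injM_le (μ : Fin d) : ‖injM Nf μ‖ ≤ 1 := by
  have h1 : ‖injM Nf μ‖ * ‖injM Nf μ‖ ≤ 1 := by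
    rw [← Matrix.l2_opNorm_conjTranspose_mul_self, conjTranspose_injM_mul_injM, ← Matrix.diagonal_one, Matrix.l2_opNorm_diagonal]
    refine (pi_norm_le_iff_of_nonneg zero_le_one).mpr fun _ => ?_
    simp
  nlinarith [norm_nonneg (injM Nf μ)]

/-- `‖injM_μᴴ‖ ≤ 1`. [folklore] -/
theorem opNorm_injM_conjTranspose_le (μ : Fin d) : ‖(injM Nf μ)ᴴ‖ ≤ 1 := by
  rw [Matrix.l2_opNorm_conjTranspose]; exact opNorm_injM_le Nf μ

/-- `S_ν·injM_μ = injM_μ·S^s_ν` (vector-index translations act componentwise). [folklore] -/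
theorem shiftM_mul_injM (ν μ : Fin d) : shiftM Nf ν * injM Nf μ = injM Nf μ * shiftS Nf ν := by
  ext i y
  rw [Matrix.mul_apply, Finset.sum_eq_single (i.1 + unitVec Nf ν, i.2), Matrix.mul_apply, Finset.sum_eq_single i.1]
  · simp only [shiftM, injM, shiftS, if_true, one_mul]
    have e1 : (((i.1 + unitVec Nf ν, i.2) : Tor Nf × Fin d) = (y, μ)) ↔ (y = i.1 + unitVec Nf ν ∧ i.2 = μ) := by
      rw [Prod.mk.injEq]; constructor <;> rintro ⟨h1, h2⟩ <;> exact ⟨h1.symm, h2⟩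
    have e2 : (i = (i.1, μ)) ↔ i.2 = μ := by
      constructor
      · intro h; rw [h]
      · intro h; rw [← h]
    simp only [e1, e2]
    by_cases h2 : i.2 = μ
    · by_cases h1 : y = i.1 + unitVec Nf ν
      · rw [if_pos ⟨h1, h2⟩, if_pos h2, if_pos h1, one_mul]
      · rw [if_neg (fun h => h1 h.1), if_pos h2, if_neg h1, mul_zero]
    · rw [if_neg (fun h => h2 h.2), if_neg h2, zero_mul]
  · intro z _ hz
    have : ¬ i = (z, μ) := fun h => hz (by rw [h])
    simp only [injM, if_neg this, zero_mul]
  · intro h; exact absurd (Finset.mem_univ _) h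
  · intro j _ hj
    simp only [shiftM, if_neg hj, zero_mul]
  · intro h; exact absurd (Finset.mem_univ _) h

omit hNf in
/-- the scalar difference unfolded. [folklore] -/
theorem sdiff_def (c : ℂ) (ν : Fin d) : sdiff Nf c ν = c • (shiftS Nf ν - 1) := rfl

/-- `∇_ν·injM_μ = injM_μ·∂_ν`. [folklore] -/
theorem fdiff_mul_injM (c : ℂ) (ν μ : Fin d) : fdiff Nf c ν * injM Nf μ = injM Nf μ * sdiff Nf c ν := by
  rw [fdiff, sdiff_def, Matrix.smul_mul, Matrix.sub_mul, Matrix.one_mul, shiftM_mul_injM, Matrix.mul_smul, Matrix.mul_sub,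
    Matrix.mul_one]

/-- `injM_μᴴ·S_ν = S^s_ν·injM_μᴴ`. [folklore] -/
theorem injMH_mul_shiftM (ν μ : Fin d) : (injM Nf μ)ᴴ * shiftM Nf ν = shiftS Nf ν * (injM Nf μ)ᴴ := by
  ext y j
  rw [Matrix.mul_apply, Finset.sum_eq_single (y, μ), Matrix.mul_apply, Finset.sum_eq_single (y + unitVec Nf ν)]
  · simp only [injM_conjTranspose_apply, shiftM, shiftS, if_true, one_mul]
  · intro z _ hz
    simp only [shiftS, if_neg (Ne.symm hz).symm, zero_mul]
  · intro h; exact absurd (Finset.mem_univ _) h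
  · intro i _ hi
    rw [injM_conjTranspose_apply, if_neg hi, zero_mul]
  · intro h; exact absurd (Finset.mem_univ _) h

/-- `injM_μᴴ·∇_ν = ∂_ν·injM_μᴴ`. [folklore] -/
theorem injMH_mul_fdiff (c : ℂ) (ν μ : Fin d) : (injM Nf μ)ᴴ * fdiff Nf c ν = sdiff Nf c ν * (injM Nf μ)ᴴ := by
  rw [fdiff, sdiff_def, Matrix.mul_smul, Matrix.mul_sub, Matrix.mul_one, injMH_mul_shiftM, Matrix.smul_mul, Matrix.sub_mul,
    Matrix.one_mul]

/-- the gradient of `B5Action121` through the injections: `∂ = Σ_μ injM_μ·∂_μ`. [cite: Balaban1984PropagatorsI, (1.4) p.18] [folklore] -/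
theorem GradOp_eq_sum_injM (c : ℂ) : GradOp Nf c = ∑ μ, injM Nf μ * sdiff Nf c μ := by
  ext i y
  rw [Matrix.sum_apply, Finset.sum_eq_single i.2]
  · rw [Matrix.mul_apply, Finset.sum_eq_single i.1]
    · simp [injM, GradOp]
    · intro z _ hz
      have : ¬ (i = (z, i.2)) := fun h => hz (by rw [h])
      simp [injM, this]
    · intro h; exact absurd (Finset.mem_univ _) h
  · intro μ _ hμ
    rw [Matrix.mul_apply, Finset.sum_eq_zero]
    intro z _
    have : ¬ (i = (z, μ)) := fun h => hμ (by rw [h])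
    simp [injM, this]
  · intro h; exact absurd (Finset.mem_univ _) h

/-- … and `∂ = Σ_μ ∇_μ·injM_μ`. [folklore] -/
theorem GradOp_eq_sum_fdiff (c : ℂ) : GradOp Nf c = ∑ μ, fdiff Nf c μ * injM Nf μ := by
  rw [GradOp_eq_sum_injM]
  exact Finset.sum_congr rfl fun μ _ => (fdiff_mul_injM Nf c μ μ).symm

/-- `∇^c_λ` commutes with the backward translation `S_μᴴ`. [folklore] -/
theorem fdiff_mul_conjTranspose_shiftM (c : ℂ) (lam μ : Fin d) :
    fdiff Nf c lam * (shiftM Nf μ)ᴴ = (shiftM Nf μ)ᴴ * fdiff Nf c lam := by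
  rw [shiftM_eq_transl, conjTranspose_transl, fdiff, shiftM_eq_transl, Matrix.smul_mul, Matrix.mul_smul, Matrix.sub_mul,
    Matrix.mul_sub, Matrix.one_mul, Matrix.mul_one, ← transl_add, ← transl_add, add_comm]

end Inj

/-! ## §2 The covariant gradient on colour 0-forms, its defect, the sandwich and the exact decomposition -/

section Cov

variable (Nf : Fin d → ℕ) [hNf : ∀ μ, NeZero (Nf μ)] {o : Type*} [Fintype o] [DecidableEq o]

/-- transporters of 0-forms read at 1-form indices (constant in the component): `R_μ(x, ν) := R_μ(x)`. [folklore] -/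
def liftR (R : Fin d → (Tor Nf → Matrix o o ℂ)) (μ : Fin d) : Tor Nf × Fin d → Matrix o o ℂ := fun i => R μ i.1

/-- the connection in lattice units, lifted: `w_μ(x, ν) = c·(R_μ(x) − 1)`. [folklore] -/
def connL (c : ℂ) (R : Fin d → (Tor Nf → Matrix o o ℂ)) (μ : Fin d) : Tor Nf × Fin d → Matrix o o ℂ := fun i => c • (R μ i.1 - 1)

/-- **THE COVARIANT GRADIENT ON COLOUR 0-FORMS** `(D_Rλ)(x, μ) = c·(R_μ(x)·λ(x + e_μ) − λ(x))`, typed as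
`Σ_μ c·(siteMul(R_μ)·(S_μ ⊗ 1) − 1)·(injM_μ ⊗ 1)` (colour transporters `R_μ(x) ∈ M_o(ℂ)` as DATA).
[cite: Balaban1985BackgroundPropagators, (3.3) p.390 (covariant derivative, shape)] [folklore] -/
def covGrad (c : ℂ) (R : Fin d → (Tor Nf → Matrix o o ℂ)) : Matrix ((Tor Nf × Fin d) × o) (Tor Nf × o) ℂ :=
  ∑ μ, (c • (siteMul (liftR Nf R μ) * shiftM Nf μ ⊗ₖ (1 : Matrix o o ℂ) - 1)) * injM Nf μ ⊗ₖ (1 : Matrix o o ℂ)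

/-- **the defect** `E = D_R − ∂ ⊗ 1 = Σ_μ siteMul(w_μ)·(S_μ ⊗ 1)·(injM_μ ⊗ 1)` (a first-order shape: bounded, no difference). [folklore] -/
def defect (c : ℂ) (R : Fin d → (Tor Nf → Matrix o o ℂ)) : Matrix ((Tor Nf × Fin d) × o) (Tor Nf × o) ℂ :=
  ∑ μ, siteMul (connL Nf c R μ) * shiftM Nf μ ⊗ₖ (1 : Matrix o o ℂ) * injM Nf μ ⊗ₖ (1 : Matrix o o ℂ)

/-- **`D_R = ∂ ⊗ 1 + E`**. [folklore] -/
theorem covGrad_eq (c : ℂ) (R : Fin d → (Tor Nf → Matrix o o ℂ)) :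
    covGrad Nf c R = GradOp Nf c ⊗ₖ (1 : Matrix o o ℂ) + defect Nf c R := by
  have hμ : ∀ μ, c • (siteMul (liftR Nf R μ) * shiftM Nf μ ⊗ₖ (1 : Matrix o o ℂ) - 1)
      = fdiff Nf c μ ⊗ₖ (1 : Matrix o o ℂ) + siteMul (connL Nf c R μ) * shiftM Nf μ ⊗ₖ (1 : Matrix o o ℂ) := by
    intro μ
    have e1 : siteMul (connL Nf c R μ) = c • (siteMul (liftR Nf R μ) - 1) := by
      rw [← siteMul_one (ι := Tor Nf × Fin d) (o := o), ← siteMul_sub, ← siteMul_smul]; rfl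
    have e2 : fdiff Nf c μ ⊗ₖ (1 : Matrix o o ℂ) = c • (shiftM Nf μ ⊗ₖ (1 : Matrix o o ℂ) - 1) := by
      rw [fdiff, Matrix.smul_kronecker, sub_kronecker, Matrix.one_kronecker_one]
    rw [e1, e2, Matrix.smul_mul, ← smul_add, Matrix.sub_mul, Matrix.one_mul]
    congr 1; abel
  rw [covGrad, defect, GradOp_eq_sum_fdiff, sum_kronecker, ← Finset.sum_add_distrib]
  refine Finset.sum_congr rfl fun μ _ => ?_
  rw [hμ, Matrix.add_mul, kron_mul]

/-- at `R = 1` the defect vanishes. [folklore] -/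
theorem defect_one (c : ℂ) : defect Nf c (fun (_ : Fin d) (_ : Tor Nf) => (1 : Matrix o o ℂ)) = 0 := by
  rw [defect]
  refine Finset.sum_eq_zero fun μ _ => ?_
  have h0 : siteMul (connL Nf c (fun (_ : Fin d) (_ : Tor Nf) => (1 : Matrix o o ℂ)) μ) = 0 := by
    ext p q; simp [siteMul_apply, connL]
  rw [h0, Matrix.zero_mul, Matrix.zero_mul]

/-- **`D_1 = ∂ ⊗ 1`**: at `U = 1` the covariant gradient is the lifted gradient of [Balaban1984PropagatorsI] (1.4). [folklore] -/
theorem covGrad_one (c : ℂ) : covGrad Nf c (fun (_ : Fin d) (_ : Tor Nf) => (1 : Matrix o o ℂ)) = GradOp Nf c ⊗ₖ (1 : Matrix o o ℂ) := by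
  rw [covGrad_eq, defect_one, add_zero]

/-- **THE GAUGE-TERM SANDWICH** `D_R·X·D_Rᴴ` with a 0-form operator `X` in the middle (the shape of `DRD*` in
[Balaban1985BackgroundPropagators] (3.26) p.395 and of `∂P∂*` in [Balaban1984PropagatorsI] (1.69) p.29; `X` is DATA). [folklore] -/
def sand (c : ℂ) (R : Fin d → (Tor Nf → Matrix o o ℂ)) (X : Matrix (Tor Nf × o) (Tor Nf × o) ℂ) :
    Matrix ((Tor Nf × Fin d) × o) ((Tor Nf × Fin d) × o) ℂ :=
  covGrad Nf c R * X * (covGrad Nf c R)ᴴ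

/-- `(D_R X D_Rᴴ)ᴴ = D_R Xᴴ D_Rᴴ`. [folklore] -/
theorem sand_conjTranspose (c : ℂ) (R : Fin d → (Tor Nf → Matrix o o ℂ)) (X : Matrix (Tor Nf × o) (Tor Nf × o) ℂ) :
    (sand Nf c R X)ᴴ = sand Nf c R Xᴴ := by
  rw [sand, sand, Matrix.conjTranspose_mul, Matrix.conjTranspose_mul, Matrix.conjTranspose_conjTranspose, Matrix.mul_assoc]

/-- **THE EXACT FOUR-TERM DECOMPOSITION** (`G = ∂ ⊗ 1`, `E` the defect):
`D_R X D_Rᴴ − D_1 X₀ D_1ᴴ = G(X − X₀)Gᴴ + E X Gᴴ + G X Eᴴ + E X Eᴴ` — the sandwich of the DIFFERENCE `X − X₀` between two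
gradients (the new shape), two first-order shapes, one zeroth-order shape. [folklore] -/
theorem sand_sub_sand (c : ℂ) (R : Fin d → (Tor Nf → Matrix o o ℂ)) (X X₀ : Matrix (Tor Nf × o) (Tor Nf × o) ℂ) :
    sand Nf c R X - sand Nf c (fun _ _ => 1) X₀
      = GradOp Nf c ⊗ₖ (1 : Matrix o o ℂ) * (X - X₀) * (GradOp Nf c ⊗ₖ (1 : Matrix o o ℂ))ᴴ
        + defect Nf c R * X * (GradOp Nf c ⊗ₖ (1 : Matrix o o ℂ))ᴴ
        + GradOp Nf c ⊗ₖ (1 : Matrix o o ℂ) * X * (defect Nf c R)ᴴ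
        + defect Nf c R * X * (defect Nf c R)ᴴ := by
  rw [sand, sand, covGrad_eq, covGrad_one]
  simp only [Matrix.conjTranspose_add, Matrix.add_mul, Matrix.mul_add, Matrix.mul_sub, Matrix.sub_mul]
  abel

/-! ## §3 Gradient-commutator data for the middle operator, and the generic sandwich bound -/

/-- **GRADIENT-COMMUTATOR DATA** for an operator `X` on colour 0-forms at lattice factor `c`: size `‖X‖ ≤ ξ` and commutators with
every lifted forward difference `‖[∂_λ ⊗ 1, X]‖ ≤ ρ` (for the identity `ρ = 0`; for the site multiplication by a colour field that
is `β/|c|`-Lipschitz per lattice step, `ρ = 3β`).  A hypothesis on DATA (the gauge projection of the background), not a fact; whether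
Bałaban's `R(U)` of (3.25) has small `ξ`, `ρ` for its difference to `R(1)` is NOT claimed here. [folklore] -/
structure GradComm (c : ℂ) (X : Matrix (Tor Nf × o) (Tor Nf × o) ℂ) (ξ ρ : ℝ) : Prop where
  /-- `ξ, ρ ≥ 0` -/
  nonneg : 0 ≤ ξ ∧ 0 ≤ ρ
  /-- size -/
  norm_le : ‖X‖ ≤ ξ
  /-- gradient commutators -/
  comm_le : ∀ lam, ‖sdiff Nf c lam ⊗ₖ (1 : Matrix o o ℂ) * X - X * sdiff Nf c lam ⊗ₖ (1 : Matrix o o ℂ)‖ ≤ ρ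

/-- the identity has data `(1, 0)`. [folklore] -/
theorem gradComm_one (c : ℂ) : GradComm Nf c (1 : Matrix (Tor Nf × o) (Tor Nf × o) ℂ) 1 0 where
  nonneg := ⟨zero_le_one, le_rfl⟩
  norm_le := by
    rw [← Matrix.diagonal_one, Matrix.l2_opNorm_diagonal]
    exact (pi_norm_le_iff_of_nonneg zero_le_one).mpr fun _ => by simp
  comm_le := fun lam => by rw [Matrix.mul_one, Matrix.one_mul, sub_self, norm_zero]

/-- data of a difference. [folklore] -/
theorem GradComm.sub {c : ℂ} {X Y : Matrix (Tor Nf × o) (Tor Nf × o) ℂ} {ξ ρ ξ' ρ' : ℝ} (hX : GradComm Nf c X ξ ρ)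
    (hY : GradComm Nf c Y ξ' ρ') : GradComm Nf c (X - Y) (ξ + ξ') (ρ + ρ') where
  nonneg := ⟨add_nonneg hX.nonneg.1 hY.nonneg.1, add_nonneg hX.nonneg.2 hY.nonneg.2⟩
  norm_le := (norm_sub_le _ _).trans (add_le_add hX.norm_le hY.norm_le)
  comm_le := fun lam => by
    have e : sdiff Nf c lam ⊗ₖ (1 : Matrix o o ℂ) * (X - Y) - (X - Y) * sdiff Nf c lam ⊗ₖ (1 : Matrix o o ℂ)
        = (sdiff Nf c lam ⊗ₖ (1 : Matrix o o ℂ) * X - X * sdiff Nf c lam ⊗ₖ (1 : Matrix o o ℂ))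
          - (sdiff Nf c lam ⊗ₖ (1 : Matrix o o ℂ) * Y - Y * sdiff Nf c lam ⊗ₖ (1 : Matrix o o ℂ)) := by
      rw [Matrix.mul_sub, Matrix.sub_mul]; abel
    rw [e]; exact (norm_sub_le _ _).trans (add_le_add (hX.comm_le lam) (hY.comm_le lam))

/-- the scalar translation through the injections: `S^s_λ = injM_λᴴ·S_λ·injM_λ`. [folklore] -/
theorem shiftS_eq (lam : Fin d) : shiftS Nf lam = (injM Nf lam)ᴴ * shiftM Nf lam * injM Nf lam := by
  rw [Matrix.mul_assoc, shiftM_mul_injM, ← Matrix.mul_assoc, conjTranspose_injM_mul_injM, Matrix.one_mul]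

/-- `‖S^s_λ‖ ≤ 1`. [folklore] -/
theorem opNorm_shiftS_le (lam : Fin d) : ‖shiftS Nf lam‖ ≤ 1 := by
  rw [shiftS_eq]
  calc _ ≤ ‖(injM Nf lam)ᴴ * shiftM Nf lam‖ * ‖injM Nf lam‖ := Matrix.l2_opNorm_mul _ _
    _ ≤ (1 * 1) * 1 := mul_le_mul ((Matrix.l2_opNorm_mul _ _).trans (mul_le_mul (opNorm_injM_conjTranspose_le Nf lam)
        (opNorm_shiftM_le Nf lam) (norm_nonneg _) zero_le_one)) (opNorm_injM_le Nf lam) (norm_nonneg _) (by norm_num)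
    _ = 1 := by norm_num

/-- `(S^s_λ ⊗ 1)·siteMul m = siteMul (m(· + e_λ))·(S^s_λ ⊗ 1)` on colour 0-forms. [folklore] -/
theorem kronShiftS_mul_siteMul (lam : Fin d) (m : Tor Nf → Matrix o o ℂ) :
    shiftS Nf lam ⊗ₖ (1 : Matrix o o ℂ) * siteMul m = siteMul (fun x => m (x + unitVec Nf lam)) * shiftS Nf lam ⊗ₖ (1 : Matrix o o ℂ) := by
  refine kron_mul_siteMul_eq fun x y hxy => ?_
  have hy : y = x + unitVec Nf lam := by
    by_contra hne; exact hxy (by simp [shiftS, hne])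
  subst hy; rfl

/-- **THE MODEL INSTANCE**: the site multiplication by a colour field of size `ξ` and Lipschitz constant `δ` per lattice step has
gradient-commutator data `(ξ, ‖c‖δ)` (`[∂_λ ⊗ 1, siteMul m] = c·siteMul(m(· + e_λ) − m)·(S^s_λ ⊗ 1)`); at `c = n`, `δ = β/n` this is
`(ξ, β)`.  Shows the hypothesis shape is inhabited by the natural local operators; says nothing about gauge projections. [folklore] -/
theorem gradComm_siteMul (c : ℂ) {m : Tor Nf → Matrix o o ℂ} {ξ δ : ℝ} (hξ : 0 ≤ ξ) (hδ : 0 ≤ δ) (hm : ∀ x, ‖m x‖ ≤ ξ)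
    (hLip : ∀ lam x, ‖m (x + unitVec Nf lam) - m x‖ ≤ δ) : GradComm Nf c (siteMul m) ξ (‖c‖ * δ) where
  nonneg := ⟨hξ, mul_nonneg (norm_nonneg c) hδ⟩
  norm_le := opNorm_siteMul_le _ hξ hm
  comm_le := fun lam => by
    have e : sdiff Nf c lam ⊗ₖ (1 : Matrix o o ℂ) * siteMul m - siteMul m * sdiff Nf c lam ⊗ₖ (1 : Matrix o o ℂ)
        = c • (siteMul (fun x => m (x + unitVec Nf lam) - m x) * shiftS Nf lam ⊗ₖ (1 : Matrix o o ℂ)) := by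
      rw [sdiff_def, Matrix.smul_kronecker, sub_kronecker, Matrix.one_kronecker_one, Matrix.smul_mul, Matrix.mul_smul,
        Matrix.sub_mul, Matrix.mul_sub, Matrix.one_mul, Matrix.mul_one, kronShiftS_mul_siteMul, ← smul_sub, siteMul_sub, Matrix.sub_mul]
      congr 1; abel
    rw [e, norm_smul]
    refine mul_le_mul_of_nonneg_left ?_ (norm_nonneg c)
    calc _ ≤ ‖siteMul (fun x => m (x + unitVec Nf lam) - m x)‖ * ‖shiftS Nf lam ⊗ₖ (1 : Matrix o o ℂ)‖ := Matrix.l2_opNorm_mul _ _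
      _ ≤ δ * 1 := mul_le_mul (opNorm_siteMul_le _ hδ (hLip lam)) (opNorm_kron_le_of_le o (opNorm_shiftS_le Nf lam))
          (norm_nonneg _) hδ
      _ = δ := mul_one δ

/-- **THE GENERIC SANDWICH BOUND**: for `GradComm X ξ ρ` and a right factor `B` with `‖B‖ ≤ b₀`, `‖(∂_λ ⊗ 1)B‖ ≤ b₁` (all `λ`):
`‖(∂ ⊗ 1)·X·B‖ ≤ d·(ξb₁ + ρb₀)` — the left-most difference is moved through `X` at the price of the commutator. [folklore] -/
theorem opNorm_grad_mul_mul_le {c : ℂ} {X : Matrix (Tor Nf × o) (Tor Nf × o) ℂ} {ξ ρ : ℝ} (hX : GradComm Nf c X ξ ρ)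
    {β' : Type*} [Fintype β'] [DecidableEq β'] {B : Matrix (Tor Nf × o) β' ℂ} {b₀ b₁ : ℝ} (hB : ‖B‖ ≤ b₀)
    (hB₁ : ∀ lam, ‖sdiff Nf c lam ⊗ₖ (1 : Matrix o o ℂ) * B‖ ≤ b₁) :
    ‖GradOp Nf c ⊗ₖ (1 : Matrix o o ℂ) * X * B‖ ≤ d * (ξ * b₁ + ρ * b₀) := by
  rw [GradOp_eq_sum_injM, sum_kronecker, Matrix.sum_mul, Matrix.sum_mul]
  refine (norm_sum_le _ _).trans ?_
  have hterm : ∀ lam ∈ Finset.univ, ‖(injM Nf lam * sdiff Nf c lam) ⊗ₖ (1 : Matrix o o ℂ) * X * B‖ ≤ ξ * b₁ + ρ * b₀ := by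
    intro lam _
    have e : (injM Nf lam * sdiff Nf c lam) ⊗ₖ (1 : Matrix o o ℂ) * X * B
        = injM Nf lam ⊗ₖ (1 : Matrix o o ℂ) * (X * (sdiff Nf c lam ⊗ₖ (1 : Matrix o o ℂ) * B)
          + (sdiff Nf c lam ⊗ₖ (1 : Matrix o o ℂ) * X - X * sdiff Nf c lam ⊗ₖ (1 : Matrix o o ℂ)) * B) := by
      rw [kron_mul, Matrix.sub_mul, Matrix.mul_assoc X, ← add_sub_assoc, add_sub_cancel_left]
      simp only [Matrix.mul_assoc]
    rw [e]
    calc _ ≤ ‖injM Nf lam ⊗ₖ (1 : Matrix o o ℂ)‖ * ‖X * (sdiff Nf c lam ⊗ₖ (1 : Matrix o o ℂ) * B)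
            + (sdiff Nf c lam ⊗ₖ (1 : Matrix o o ℂ) * X - X * sdiff Nf c lam ⊗ₖ (1 : Matrix o o ℂ)) * B‖ := Matrix.l2_opNorm_mul _ _
      _ ≤ 1 * (ξ * b₁ + ρ * b₀) := by
          refine mul_le_mul (opNorm_kron_le_of_le o (opNorm_injM_le Nf lam)) ((norm_add_le _ _).trans (add_le_add ?_ ?_))
            (norm_nonneg _) zero_le_one
          · exact (Matrix.l2_opNorm_mul _ _).trans (mul_le_mul hX.norm_le (hB₁ lam) (norm_nonneg _) hX.nonneg.1)
          · exact (Matrix.l2_opNorm_mul _ _).trans (mul_le_mul (hX.comm_le lam) hB (norm_nonneg _) hX.nonneg.2)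
      _ = ξ * b₁ + ρ * b₀ := one_mul _
  refine (Finset.sum_le_sum hterm).trans (le_of_eq ?_)
  rw [Finset.sum_const, Finset.card_univ, Fintype.card_fin, nsmul_eq_mul]

/-- **`‖E‖ ≤ d·α`** from the size `‖w_μ(x)‖ ≤ α` of the connection. [folklore] -/
theorem opNorm_defect_le (c : ℂ) {R : Fin d → (Tor Nf → Matrix o o ℂ)} {α : ℝ} (hα : 0 ≤ α)
    (hR : ∀ μ i, ‖connL Nf c R μ i‖ ≤ α) : ‖defect Nf c R‖ ≤ d * α := by
  rw [defect]
  refine (norm_sum_le _ _).trans ?_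
  have hterm : ∀ μ ∈ Finset.univ,
      ‖siteMul (connL Nf c R μ) * shiftM Nf μ ⊗ₖ (1 : Matrix o o ℂ) * injM Nf μ ⊗ₖ (1 : Matrix o o ℂ)‖ ≤ α := by
    intro μ _
    calc _ ≤ ‖siteMul (connL Nf c R μ) * shiftM Nf μ ⊗ₖ (1 : Matrix o o ℂ)‖ * ‖injM Nf μ ⊗ₖ (1 : Matrix o o ℂ)‖ :=
          Matrix.l2_opNorm_mul _ _
      _ ≤ (α * 1) * 1 :=
          mul_le_mul ((Matrix.l2_opNorm_mul _ _).trans (mul_le_mul (opNorm_siteMul_le _ hα (hR μ))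
            (opNorm_kron_le_of_le o (opNorm_shiftM_le _ μ)) (norm_nonneg _) hα))
            (opNorm_kron_le_of_le o (opNorm_injM_le _ μ)) (norm_nonneg _) (by positivity)
      _ = α := by ring
  refine (Finset.sum_le_sum hterm).trans (le_of_eq ?_)
  rw [Finset.sum_const, Finset.card_univ, Fintype.card_fin, nsmul_eq_mul]

end Cov


end Summit.QuantumFields.BalabanUV.T4Continuum.GaugeTermDecomposition

end
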